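import Literature.AlgebraicGeometry.HodgeTheory.DworkSexticSingletonPurity
import Literature.AlgebraicGeometry.HodgeTheory.DworkSexticSingletonRankOfTransport
import Literature.AlgebraicGeometry.HodgeTheory.DiagonalSymmetryStability
import Mathlib.GroupTheory.FiniteAbelian.Duality
import HarnessLib

/-!
# Hodge classes of the Dwork sextic fourfold modulo its `Γ_W`-invariant part: every rational
# `(2,2)`-class is `π₁ c` plus a combination of reflection-invariant rational `(2,2)`-classes

Family `hodge`, layer `Literature/AlgebraicGeometry/HodgeTheory`; PROOF FILE (theorems only, no
definition, no named fact), namespace `Literature.AlgebraicGeometry.HodgeTheory.DworkSextic`. A sequel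
to `DworkSexticReflectionAveraging` (six-reflection averaging: a rational `(2,2)`-class `w = u + v` with
`u ∈ V_e`, `v ∈ V_{e'}`, `eᵢ ≢ eⱼ`, `e'ᵢ ≢ e'ⱼ (mod 6)`, lies in the `ℂ`-span of the rational
`(2,2)`-classes fixed by a realised reflection `s_(i,j,ζ)`), `DiagonalCharacterEigenspace` /
`DiagonalSymmetryStability` (isotypic projectors `π_θ` of the diagonal group `Γ_W`, `Σ_θ π_θ = id`,
rationality of `π_θ c + π_{θ⁻¹} c`, stability of Hodge types and algebraic classes) and
`DworkSexticFlatEigenclassesHodgeType` (`Γ_W = gammaW`, its characters `character e`).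

For the Dwork sextic fourfold `X_ψ : Σ xₗ⁶ − 6ψ ∏ xₗ = 0 ⊂ ℙ⁵_ℂ`, `ψ⁶ ≠ 1`, with its diagonal
symmetry group `Γ_W = {a ∈ μ₆⁶ : ∏ aₗ = 1}` (Katz 2009, §2–§3) and its 90 coordinate reflections
`s_(i,j,ζ)` (Bini–Garbagnati 2012, §3.4), we PROVE:

* `exists_character_eq` — every character of `Γ_W` is `χ_e : a ↦ ∏ aₗ^{eₗ}` for some exponent vector
  `e` (characters of a subgroup of `μ₆⁶` extend, Mathlib's duality `MonoidHom.restrict_surjective`, and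
  the characters of `μ₆⁶` are the `χ_α`, `fermatCharacter_bijective`);
* `exists_ne_of_character_ne_one` — a non-trivial `χ_e` has `eᵢ ≢ eⱼ (mod 6)` for some `i ≠ j`
  (a constant exponent vector gives `∏ aₗ^r = (∏ aₗ)^r = 1`);
* `isEig_of_mem_eigenspace` — the converse bridge `c ∈ V_{χ_e} → IsEig ψ e c` to
  `mem_eigenspace_of_isEig`;
* **`sub_eigenProjector_one_mem_span_reflInvariant` (main theorem)** — for `ψ⁶ ≠ 1` and every
  RATIONAL class `c ∈ H⁴(X_ψ(ℂ); ℂ)` of Hodge type `(2,2)`, the class `c − π₁ c` (`π₁` the projector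
  onto the `Γ_W`-invariants) lies in the `ℂ`-span of the rational `(2,2)`-classes fixed by a realised
  reflection: `2(c − π₁ c) = Σ_{θ ≠ 1} (π_θ c + π_{θ⁻¹} c)`, each summand being a rational
  (`ζ + ζ⁻¹ ∈ ℚ` for `ζ⁶ = 1`) `(2,2)`-class of the form `u + v`, `u ∈ V_θ`, `v ∈ V_{θ⁻¹}`, with
  `θ = χ_e` non-constant — exactly the input of the six-reflection averaging, FOR EVERY non-trivial
  character, flat or not;
* `isRationalClass_eigenProjector_one`, `isOfHodgeType_eigenProjector_one`,
  `isEig_zero_eigenProjector_one`, `eigenProjector_one_eq_self_of_isEig_zero` — `π₁ c` is a rational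
  `(2,2)`-class of the trivial character, and `π₁ = id` on such classes;
* **`mem_algebraicClasses_of_reflInvariant_of_invariant`** — consequently, if at `ψ` (i) every
  reflection-invariant rational `(2,2)`-class is algebraic (the content of crux
  `ReflectionQuotientDescent` of route `HodgeConjecture/DworkReflectionQuotients`, taken here as an
  explicit hypothesis) and (ii) every `Γ_W`-INVARIANT rational `(2,2)`-class is algebraic, then EVERY
  rational `(2,2)`-class on `X_ψ` is algebraic. The non-flat, non-trivial character blocks never need a
  separate analysis (no irreducibility of their monodromy à la Katz 2009 Thm. 5.3 is used): their Hodge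
  classes, whenever they occur, are averaged over reflections like the flat ones.

## References

* N. M. Katz, *Another look at the Dwork family*, Progr. Math. 270 (2009), §2 pp. 5–7, §3, Lemma 3.1.
  [Katz2009]
* G. Bini, A. Garbagnati, *Quotients of the Dwork pencil*, J. Geom. Phys. 75 (2014) = arXiv:1207.7175,
  §3.4. [BiniGarbagnati2012]
* J.-P. Serre, *Linear Representations of Finite Groups* (1977), §2.6 Thm. 8 (canonical decomposition).
  [SerreLinearRepresentations1977]
* C. Voisin, *Hodge Theory and Complex Algebraic Geometry I* (2002), §7.1.1, §7.3.2, §11.3.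
  [VoisinHodgeI2002]
-/

noncomputable section

open CategoryTheory Finset
open scoped BigOperators

namespace Literature.AlgebraicGeometry.HodgeTheory.DworkSextic

open Literature.AlgebraicGeometry.Motives Literature.AlgebraicTopology.SingularHomology

/-! ### §1 Characters of `Γ_W`: every character is a `χ_e`; non-trivial ones are non-constant -/

section Characters

/-- A sixth root of unity `z` has `z + z⁻¹ ∈ ℚ` (`∈ {2, 1, −1, −2}`; the real cyclotomic field
`ℚ(ζ₆)⁺` is `ℚ`): from `z⁶ − 1 = (z − 1)(z + 1)(z² + z + 1)(z² − z + 1)`. [cite: Katz2009, §2 p. 5] -/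
theorem exists_ratCast_eq_add_inv_of_pow_six_eq_one {z : ℂ} (hz : z ^ 6 = 1) :
    ∃ q : ℚ, (q : ℂ) = z + z⁻¹ := by
  have hfac : (z - 1) * (z + 1) * (z ^ 2 + z + 1) * (z ^ 2 - z + 1) = 0 := by
    have h : (z - 1) * (z + 1) * (z ^ 2 + z + 1) * (z ^ 2 - z + 1) = z ^ 6 - 1 := by ring
    rw [h, hz, sub_self]
  rcases mul_eq_zero.mp hfac with h | h
  · rcases mul_eq_zero.mp h with h | h
    · rcases mul_eq_zero.mp h with h | h
      · have h1 : z = 1 := sub_eq_zero.mp h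
        exact ⟨2, by rw [h1, inv_one]; norm_num⟩
      · have h1 : z = -1 := eq_neg_of_add_eq_zero_left h
        exact ⟨-2, by rw [h1, inv_neg, inv_one]; norm_num⟩
    · have hinv : z⁻¹ = -(z + 1) := inv_eq_of_mul_eq_one_right (by linear_combination -h)
      exact ⟨-1, by rw [hinv]; push_cast; ring⟩
  · have hinv : z⁻¹ = 1 - z := inv_eq_of_mul_eq_one_right (by linear_combination -h)
    exact ⟨1, by rw [hinv]; push_cast; ring⟩

/-- Every value of a character `θ` of `Γ_W` is a sixth root of unity (`a⁶ = 1` in `Γ_W ⊆ μ₆⁶`).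
[cite: Katz2009, §2 p. 5] -/
theorem monoidHom_apply_pow_six (θ : gammaW →* ℂˣ) (a : gammaW) : ((θ a : ℂˣ) : ℂ) ^ 6 = 1 := by
  have ha : a ^ 6 = 1 := by
    refine Subtype.ext (funext fun i => ?_)
    change ((a : Fin (4 + 2) → ℂˣ) ^ 6) i = 1
    rw [Pi.pow_apply]
    exact (mem_gammaW_iff.mp a.2).1 i
  rw [← Units.val_pow_eq_pow_val, ← map_pow, ha, map_one, Units.val_one]

/-- Hence `θ(a) + θ(a)⁻¹ ∈ ℚ` for every character `θ` of `Γ_W` — the hypothesis of the tree's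
`isRationalClass_eigenProjector_add` (rationality of `π_θ c + π_{θ⁻¹} c`). [cite: Katz2009, §2 p. 5] -/
theorem exists_ratCast_eq_monoidHom_add_inv (θ : gammaW →* ℂˣ) (a : gammaW) :
    ∃ q : ℚ, (q : ℂ) = ((θ a : ℂˣ) : ℂ) + ((θ a : ℂˣ) : ℂ)⁻¹ :=
  exists_ratCast_eq_add_inv_of_pow_six_eq_one (monoidHom_apply_pow_six θ a)

/-- The characters of the finite group `Γ_W` form a finite set (`|Γ̂_W| = |Γ_W|`). [folklore] -/
private theorem finite_monoidHom_gammaW : Finite (gammaW →* ℂˣ) :=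
  Nat.finite_of_card_ne_zero (by
    rw [CommGroup.card_monoidHom_of_hasEnoughRootsOfUnity gammaW ℂ]
    exact (Nat.card_pos (α := gammaW)).ne')

/-- **Every character of `Γ_W` is a `χ_e`.** A character `θ` of the subgroup `Γ_W ≤ μ₆⁶` extends to a
character of `μ₆⁶` (duality for finite commutative groups, Mathlib `MonoidHom.restrict_surjective`),
which is some `χ_α`, `α ∈ (ℤ/6)⁶` (`fermatCharacter_bijective`), and `χ_α|_{Γ_W} = χ_e` for
`e = (⟨αₗ⟩)ₗ` (`fermatCharacter_comp_inclusion`). Katz: the characters of `Γ_W/Δ` are the classes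
`V mod W` of exponent vectors. [cite: Katz2009, §2 pp. 5–6] -/
theorem exists_character_eq (θ : gammaW →* ℂˣ) : ∃ e : Fin 6 → ℕ, character e = θ := by
  classical
  let H : Subgroup (fermatGroup 4 6) := gammaW.subgroupOf (fermatGroup 4 6)
  let ι : H ≃* gammaW := Subgroup.subgroupOfEquivOfLe gammaW_le_fermatGroup
  haveI : Finite (H →* ℂˣ) :=
    Nat.finite_of_card_ne_zero (by
      rw [CommGroup.card_monoidHom_of_hasEnoughRootsOfUnity H ℂ]
      exact (Nat.card_pos (α := H)).ne')
  let θ' : H →* ℂˣ := θ.comp ι.toMonoidHom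
  obtain ⟨Θ, hΘ⟩ := MonoidHom.restrict_surjective ℂ H θ'
  obtain ⟨α, hα⟩ := (fermatCharacter_bijective (n := 4) (m := 6)).2 Θ
  refine ⟨fun k => (α k).val, ?_⟩
  rw [← fermatCharacter_comp_inclusion, hα]
  refine MonoidHom.ext fun a => ?_
  have h1 : θ a = θ' (ι.symm a) := by
    change θ a = θ (ι.toMonoidHom (ι.symm a))
    rw [MulEquiv.coe_toMonoidHom, MulEquiv.apply_symm_apply]
  have h2 := DFunLike.congr_fun hΘ (ι.symm a)
  rw [MonoidHom.restrictHom_apply, MonoidHom.restrict_apply] at h2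
  rw [MonoidHom.comp_apply, h1, ← h2]
  rfl

/-- A CONSTANT exponent vector carries the trivial character of `Γ_W`: `∏ aₗ^r = (∏ aₗ)^r = 1`
(Katz: the characters are exponent vectors modulo `W = (1,…,1)`). [cite: Katz2009, §2 p. 6] -/
theorem character_const (r : ℕ) : character (fun _ : Fin 6 => r) = 1 := by
  refine MonoidHom.ext fun a => ?_
  change (∏ i, (a : Fin (4 + 2) → ℂˣ) i ^ r) = 1
  rw [Finset.prod_pow, (mem_gammaW_iff.mp a.2).2, one_pow]

/-- **A non-trivial character `χ_e` of `Γ_W` is non-constant**: `eᵢ ≢ eⱼ (mod 6)` for some `i ≠ j`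
(otherwise `e ≡ r·𝟙 (mod 6)` and `χ_e = χ_{r𝟙} = 1`, `character_eq_of_mod_eq`, `character_const`).
[cite: Katz2009, §2 p. 6] -/
theorem exists_ne_of_character_ne_one {e : Fin 6 → ℕ} (h : character e ≠ 1) :
    ∃ i j : Fin 6, i ≠ j ∧ (e i : ZMod 6) ≠ (e j : ZMod 6) := by
  by_contra hne
  push Not at hne
  apply h
  have hmod : ∀ k, e k % 6 = (fun _ : Fin 6 => e 0) k % 6 := fun k => by
    by_cases hk : k = 0
    · rw [hk]
    · exact (ZMod.natCast_eq_natCast_iff' _ _ 6).mp (hne k 0 hk)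
  rw [character_eq_of_mod_eq hmod, character_const]

/-- If `eᵢ ≢ eⱼ (mod 6)` then also `5eᵢ ≢ 5eⱼ (mod 6)` (`5` is a unit mod `6`; `χ_{5e} = χ_e⁻¹`).
[cite: Katz2009, §2 p. 5] -/
theorem five_mul_ne_of_ne {e : Fin 6 → ℕ} {i j : Fin 6} (h : (e i : ZMod 6) ≠ (e j : ZMod 6)) :
    ((5 * e i : ℕ) : ZMod 6) ≠ ((5 * e j : ℕ) : ZMod 6) := by
  intro h5
  push_cast at h5
  apply h
  have h6 : (6 : ZMod 6) = 0 := by decide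
  linear_combination (5 : ZMod 6) * h5 + (-4 * (e i : ZMod 6) + 4 * (e j : ZMod 6)) * h6

/-- `1⁻¹ = 1` for characters of `Γ_W`, in the syntactic form produced by the tree's `χ⁻¹`
(pointwise inverse of monoid homomorphisms). [folklore] -/
private theorem inv_one_monoidHom_gammaW : (1 : gammaW →* ℂˣ)⁻¹ = 1 := by
  ext a : 1
  rw [MonoidHom.inv_apply, MonoidHom.one_apply, inv_one]

end Characters

/-! ### §2 The eigenclass predicate versus the character eigenspaces of the tree -/

section Bridge

variable {ψ : ℂ}

/-- **Converse bridge**: a class in the `χ_e`-eigenspace `diagonalCharacterEigenspace (form ψ) Γ_W χ_e`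
of the tree satisfies the route's eigenclass predicate `IsEig ψ e` (a vector `a ∈ ℂ⁶` with `aᵢ⁶ = 1`,
`∏ aᵢ = 1` is the vector of values of an element of `Γ_W`, and `a * v = a • v`; companion of
`mem_eigenspace_of_isEig`). [cite: Katz2009, §2 pp. 5–7] -/
theorem isEig_of_mem_eigenspace {e : Fin 6 → ℕ} {c : complexBetti (fibre ψ) (2 * 2)}
    (hc : c ∈ diagonalCharacterEigenspace (form ψ) gammaW (character e) (2 * 2)) : IsEig ψ e c := by
  intro a ha hprod g hg
  have ha0 : ∀ i, a i ≠ 0 := ne_zero_of_pow_six ha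
  let a' : Fin (4 + 2) → ℂˣ := fun i => Units.mk0 (a i) (ha0 i)
  have hval : (fun i => ((a' i : ℂˣ) : ℂ)) = a := funext fun _ => rfl
  have ha' : a' ∈ gammaW := by
    refine mem_gammaW_iff.mpr ⟨fun i => Units.ext ?_, Units.ext ?_⟩
    · rw [Units.val_pow_eq_pow_val, Units.val_one]; exact ha i
    · rw [Units.coe_prod, Units.val_one]; exact hprod
  have hact : ActsDiagonally (form ψ) a' g := by
    intro x
    obtain ⟨t, ht⟩ := hg x
    exact ⟨t, by rw [ht, ← val_mul_eq_smul, hval]⟩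
  have h := hc ⟨a', ha'⟩ g hact
  rw [h, character_apply_val]
  rfl

/-- The two descriptions agree: `IsEig ψ e c ↔ c ∈ V_{χ_e}`. [cite: Katz2009, §2 pp. 5–7] -/
theorem isEig_iff_mem_eigenspace {e : Fin 6 → ℕ} {c : complexBetti (fibre ψ) (2 * 2)} :
    IsEig ψ e c ↔ c ∈ diagonalCharacterEigenspace (form ψ) gammaW (character e) (2 * 2) :=
  ⟨mem_eigenspace_of_isEig, isEig_of_mem_eigenspace⟩

end Bridge

/-! ### §3 The main theorem: `c − π₁ c` is a combination of reflection-invariant rational `(2,2)`-classes -/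

section Main

variable {ψ : ℂ}

/-- **One paired block.** For `ψ⁶ ≠ 1`, a rational `(2,2)`-class `c` and a NON-TRIVIAL character `θ`
of `Γ_W`, the class `π_θ c + π_{θ⁻¹} c` lies in the `ℂ`-span of the rational `(2,2)`-classes fixed by a
realised reflection `s_(i,i',ζ)`: it is rational (`θ(a) + θ(a)⁻¹ ∈ ℚ`), of type `(2,2)` (`π_θ` preserves
Hodge types), and of the form `u + v` with `u ∈ V_{χ_e}`, `v ∈ V_{χ_{5e}}`, `θ = χ_e` non-constant, so the
six-reflection averaging `mem_span_reflInvariant_of_isEig_add` applies. [cite: Katz2009, §2 pp. 5–7]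
[cite: BiniGarbagnati2012, §3.4] [cite: SerreLinearRepresentations1977, §2.6 Thm. 8] -/
theorem eigenProjector_add_inv_mem_span_reflInvariant (hψ : ψ ^ 6 ≠ 1) (θ : gammaW →* ℂˣ)
    (hθ : θ ≠ 1) {c : complexBetti (fibre ψ) (2 * 2)} (hrat : IsRationalClass c)
    (hhodge : IsOfHodgeType 4 (fibre ψ) (2 * 2) 2 2 c) :
    eigenProjector (form ψ) θ (2 * 2) (gammaW_le_diagonalStabilizer ψ) c +
        eigenProjector (form ψ) θ⁻¹ (2 * 2) (gammaW_le_diagonalStabilizer ψ) c ∈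
      Submodule.span ℂ {c : complexBetti (fibre ψ) (2 * 2) | IsRationalClass c ∧
        IsOfHodgeType 4 (fibre ψ) (2 * 2) 2 2 c ∧ ∃ i i' : Fin 6, i ≠ i' ∧ ∃ ζ : ℂ, ζ ^ 6 = 1 ∧
          ∃ g : C(Motives.ComplexPoints (fibre ψ), Motives.ComplexPoints (fibre ψ)),
            (∀ x, ∃ t : ℂ, (pt ψ (g x)).rep = t • (fun k => if k = i then ζ * (pt ψ x).rep i'
              else if k = i' then ζ⁻¹ * (pt ψ x).rep i else (pt ψ x).rep k)) ∧
            singularCohomology.map ℂ ℂ g (2 * 2) c = c} := by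
  have hG := gammaW_le_diagonalStabilizer ψ
  have hX := isSmoothProjective_fibre hψ
  obtain ⟨e, rfl⟩ := exists_character_eq θ
  obtain ⟨i, j, hij, hne⟩ := exists_ne_of_character_ne_one hθ
  have hu : IsEig ψ e (eigenProjector (form ψ) (character e) (2 * 2) hG c) :=
    isEig_of_mem_eigenspace (eigenProjector_mem (form ψ) hG c)
  have hv : IsEig ψ (fun l => 5 * e l) (eigenProjector (form ψ) (character e)⁻¹ (2 * 2) hG c) := by
    refine isEig_of_mem_eigenspace ?_
    rw [← character_inv]
    exact eigenProjector_mem (form ψ) hG c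
  exact mem_span_reflInvariant_of_isEig_add hψ hij hne (five_mul_ne_of_ne hne) hu hv rfl
    (isRationalClass_eigenProjector_add (form ψ) hG hrat (exists_ratCast_eq_monoidHom_add_inv _))
    ((hhodge.eigenProjector (form ψ) hG (character e) hX).add hX
      (hhodge.eigenProjector (form ψ) hG (character e)⁻¹ hX))

/-- **Main theorem.** For `ψ⁶ ≠ 1` and a RATIONAL class `c ∈ H⁴(X_ψ(ℂ); ℂ)` of Hodge type `(2,2)`,
the class `c − π₁ c` (`π₁ = |Γ_W|⁻¹ Σ_a g_a^*` the projector onto the `Γ_W`-invariants) lies in the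
`ℂ`-span of the rational `(2,2)`-classes fixed by a realised reflection `s_(i,i',ζ)` (`ζ⁶ = 1`, `i ≠ i'`):
`2(c − π₁ c) = Σ_{θ ≠ 1} (π_θ c + π_{θ⁻¹} c)` (from `Σ_θ π_θ = id` twice), and each summand is in the span
by `eigenProjector_add_inv_mem_span_reflInvariant`. The set on the right is literally the one of crux K2 /
the hypothesis shape of crux K1 of route `HodgeConjecture/DworkReflectionQuotients`.
[cite: Katz2009, §2 pp. 5–7 and §3] [cite: BiniGarbagnati2012, §3.4]
[cite: SerreLinearRepresentations1977, §2.6 Thm. 8] -/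
theorem sub_eigenProjector_one_mem_span_reflInvariant (hψ : ψ ^ 6 ≠ 1)
    {c : complexBetti (fibre ψ) (2 * 2)} (hrat : IsRationalClass c)
    (hhodge : IsOfHodgeType 4 (fibre ψ) (2 * 2) 2 2 c) :
    c - eigenProjector (form ψ) 1 (2 * 2) (gammaW_le_diagonalStabilizer ψ) c ∈
      Submodule.span ℂ {c : complexBetti (fibre ψ) (2 * 2) | IsRationalClass c ∧
        IsOfHodgeType 4 (fibre ψ) (2 * 2) 2 2 c ∧ ∃ i i' : Fin 6, i ≠ i' ∧ ∃ ζ : ℂ, ζ ^ 6 = 1 ∧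
          ∃ g : C(Motives.ComplexPoints (fibre ψ), Motives.ComplexPoints (fibre ψ)),
            (∀ x, ∃ t : ℂ, (pt ψ (g x)).rep = t • (fun k => if k = i then ζ * (pt ψ x).rep i'
              else if k = i' then ζ⁻¹ * (pt ψ x).rep i else (pt ψ x).rep k)) ∧
            singularCohomology.map ℂ ℂ g (2 * 2) c = c} := by
  classical
  haveI : Finite (gammaW →* ℂˣ) := finite_monoidHom_gammaW
  haveI : Fintype (gammaW →* ℂˣ) := Fintype.ofFinite _
  set hG := gammaW_le_diagonalStabilizer ψ with hG_def
  set S := Submodule.span ℂ {c : complexBetti (fibre ψ) (2 * 2) | IsRationalClass c ∧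
        IsOfHodgeType 4 (fibre ψ) (2 * 2) 2 2 c ∧ ∃ i i' : Fin 6, i ≠ i' ∧ ∃ ζ : ℂ, ζ ^ 6 = 1 ∧
          ∃ g : C(Motives.ComplexPoints (fibre ψ), Motives.ComplexPoints (fibre ψ)),
            (∀ x, ∃ t : ℂ, (pt ψ (g x)).rep = t • (fun k => if k = i then ζ * (pt ψ x).rep i'
              else if k = i' then ζ⁻¹ * (pt ψ x).rep i else (pt ψ x).rep k)) ∧
            singularCohomology.map ℂ ℂ g (2 * 2) c = c} with hS_def
  -- the paired blocks `w θ = π_θ c + π_{θ⁻¹} c`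
  set w : (gammaW →* ℂˣ) → complexBetti (fibre ψ) (2 * 2) := fun θ =>
    eigenProjector (form ψ) θ (2 * 2) hG c + eigenProjector (form ψ) θ⁻¹ (2 * 2) hG c with hw_def
  have hsum : ∑ θ, eigenProjector (form ψ) θ (2 * 2) hG c = c := sum_eigenProjector_apply (form ψ) hG c
  have hsum' : ∑ θ, eigenProjector (form ψ) θ⁻¹ (2 * 2) hG c = c :=
    (Fintype.sum_equiv (Equiv.inv (gammaW →* ℂˣ))
      (fun θ => eigenProjector (form ψ) θ⁻¹ (2 * 2) hG c)
      (fun θ => eigenProjector (form ψ) θ (2 * 2) hG c) fun θ => rfl).trans hsum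
  have hsumw : ∑ θ, w θ = (2 : ℂ) • c := by
    simp only [hw_def, Finset.sum_add_distrib, hsum, hsum', two_smul]
  have hw1 : w 1 = (2 : ℂ) • eigenProjector (form ψ) 1 (2 * 2) hG c := by
    simp only [hw_def]
    rw [inv_one_monoidHom_gammaW, two_smul]
  -- `2 • (c − π₁ c) = Σ_{θ ≠ 1} w θ`
  have hsplit : (2 : ℂ) • (c - eigenProjector (form ψ) 1 (2 * 2) hG c) =
      ∑ θ ∈ Finset.univ.erase 1, w θ := by
    rw [smul_sub, ← hsumw, ← hw1, ← Finset.add_sum_erase Finset.univ w (Finset.mem_univ 1),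
      add_sub_cancel_left]
  have hmem : (2 : ℂ) • (c - eigenProjector (form ψ) 1 (2 * 2) hG c) ∈ S := by
    rw [hsplit]
    refine Submodule.sum_mem _ fun θ hθ => ?_
    have hθ1 : θ ≠ 1 := Finset.ne_of_mem_erase hθ
    exact eigenProjector_add_inv_mem_span_reflInvariant hψ θ hθ1 hrat hhodge
  have h2 : c - eigenProjector (form ψ) 1 (2 * 2) hG c =
      (2 : ℂ)⁻¹ • ((2 : ℂ) • (c - eigenProjector (form ψ) 1 (2 * 2) hG c)) := by
    rw [smul_smul, inv_mul_cancel₀ (two_ne_zero' ℂ), one_smul]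
  rw [h2]
  exact Submodule.smul_mem _ _ hmem

/-! ### §4 The invariant part `π₁ c` -/

/-- `π₁ c` is rational for rational `c` (`2 π₁ c = π₁ c + π_{1⁻¹} c` is, `isRationalClass_eigenProjector_add`).
[cite: Katz2009, §3] -/
theorem isRationalClass_eigenProjector_one {c : complexBetti (fibre ψ) (2 * 2)} (hrat : IsRationalClass c) :
    IsRationalClass (eigenProjector (form ψ) 1 (2 * 2) (gammaW_le_diagonalStabilizer ψ) c) := by
  have h := isRationalClass_eigenProjector_add (form ψ) (gammaW_le_diagonalStabilizer ψ) (χ := 1)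
    (k := 2 * 2) hrat (exists_ratCast_eq_monoidHom_add_inv 1)
  rw [inv_one_monoidHom_gammaW, ← two_smul ℂ] at h
  have h' := h.smul (1 / 2 : ℚ)
  rw [smul_smul] at h'
  convert h' using 2
  push_cast
  norm_num

/-- `π₁ c` is of type `(2,2)` for `c` of type `(2,2)` (`ψ⁶ ≠ 1`). [cite: VoisinHodgeI2002, §7.3.2] -/
theorem isOfHodgeType_eigenProjector_one (hψ : ψ ^ 6 ≠ 1) {c : complexBetti (fibre ψ) (2 * 2)}
    (hhodge : IsOfHodgeType 4 (fibre ψ) (2 * 2) 2 2 c) :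
    IsOfHodgeType 4 (fibre ψ) (2 * 2) 2 2
      (eigenProjector (form ψ) 1 (2 * 2) (gammaW_le_diagonalStabilizer ψ) c) :=
  hhodge.eigenProjector (form ψ) (gammaW_le_diagonalStabilizer ψ) 1 (isSmoothProjective_fibre hψ)

/-- `π₁ c` is an eigenclass of the zero exponent vector, i.e. `Γ_W`-invariant: `IsEig ψ 0 (π₁ c)`
(`χ₀ = 1`, `character_zero`). [cite: Katz2009, §3] -/
theorem isEig_zero_eigenProjector_one (c : complexBetti (fibre ψ) (2 * 2)) :
    IsEig ψ (fun _ => 0) (eigenProjector (form ψ) 1 (2 * 2) (gammaW_le_diagonalStabilizer ψ) c) := by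
  refine isEig_of_mem_eigenspace ?_
  rw [character_zero]
  exact eigenProjector_mem (form ψ) (gammaW_le_diagonalStabilizer ψ) c

/-- On a `Γ_W`-invariant class (`IsEig ψ 0 c`) the projector `π₁` is the identity. [cite: Katz2009, §3]
[cite: SerreLinearRepresentations1977, §2.6 Thm. 8] -/
theorem eigenProjector_one_eq_self_of_isEig_zero {c : complexBetti (fibre ψ) (2 * 2)}
    (hc : IsEig ψ (fun _ => 0) c) :
    eigenProjector (form ψ) 1 (2 * 2) (gammaW_le_diagonalStabilizer ψ) c = c := by
  refine eigenProjector_apply_of_mem (form ψ) (gammaW_le_diagonalStabilizer ψ) ?_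
  rw [← character_zero]
  exact mem_eigenspace_of_isEig hc

/-- `π₁` kills the reflection-averaged part: `π₁ (c − π₁ c) = 0` (`π₁` is idempotent). [cite: SerreLinearRepresentations1977, §2.6 Thm. 8] -/
theorem eigenProjector_one_sub_eigenProjector_one (c : complexBetti (fibre ψ) (2 * 2)) :
    eigenProjector (form ψ) 1 (2 * 2) (gammaW_le_diagonalStabilizer ψ)
        (c - eigenProjector (form ψ) 1 (2 * 2) (gammaW_le_diagonalStabilizer ψ) c) = 0 := by
  rw [map_sub, eigenProjector_idem, sub_self]

/-! ### §5 Consequence: all Hodge classes of `X_ψ` are algebraic once the reflection-invariant and the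
`Γ_W`-invariant ones are -/

/-- **The Hodge classes of `X_ψ` modulo its invariant part.** Let `ψ⁶ ≠ 1`. Suppose (i) every rational
`(2,2)`-class on `X_ψ` fixed by a realised reflection `s_(i,i',ζ)` is algebraic (the statement of crux
`ReflectionQuotientDescent` of route `HodgeConjecture/DworkReflectionQuotients` at `ψ`: such classes
descend to the reflection quotient `X_ψ/⟨s⟩`), and (ii) every `Γ_W`-invariant rational `(2,2)`-class
(`IsEig ψ 0 c`) is algebraic. Then EVERY rational `(2,2)`-class `c ∈ H⁴(X_ψ(ℂ); ℂ)` is algebraic: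
`c = π₁ c + (c − π₁ c)` with `π₁ c` as in (ii) (`isEig_zero_eigenProjector_one`) and `c − π₁ c` in the
span of the classes of (i) (`sub_eigenProjector_one_mem_span_reflInvariant`), `algebraicClasses` being a
`ℂ`-subspace. [cite: Katz2009, §3] [cite: BiniGarbagnati2012, §3.4] [cite: VoisinHodgeI2002, §11.3] -/
theorem mem_algebraicClasses_of_reflInvariant_of_invariant (hψ : ψ ^ 6 ≠ 1)
    (hrefl : ∀ c : complexBetti (fibre ψ) (2 * 2), IsRationalClass c →
      IsOfHodgeType 4 (fibre ψ) (2 * 2) 2 2 c →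
      (∃ i i' : Fin 6, i ≠ i' ∧ ∃ ζ : ℂ, ζ ^ 6 = 1 ∧
        ∃ g : C(Motives.ComplexPoints (fibre ψ), Motives.ComplexPoints (fibre ψ)),
          (∀ x, ∃ t : ℂ, (pt ψ (g x)).rep = t • (fun k => if k = i then ζ * (pt ψ x).rep i'
            else if k = i' then ζ⁻¹ * (pt ψ x).rep i else (pt ψ x).rep k)) ∧
          singularCohomology.map ℂ ℂ g (2 * 2) c = c) →
      c ∈ algebraicClasses (fibre ψ) 2)
    (hinv : ∀ c : complexBetti (fibre ψ) (2 * 2), IsRationalClass c →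
      IsOfHodgeType 4 (fibre ψ) (2 * 2) 2 2 c → IsEig ψ (fun _ => 0) c → c ∈ algebraicClasses (fibre ψ) 2)
    {c : complexBetti (fibre ψ) (2 * 2)} (hrat : IsRationalClass c)
    (hhodge : IsOfHodgeType 4 (fibre ψ) (2 * 2) 2 2 c) :
    c ∈ algebraicClasses (fibre ψ) 2 := by
  have h1 : eigenProjector (form ψ) 1 (2 * 2) (gammaW_le_diagonalStabilizer ψ) c ∈
      algebraicClasses (fibre ψ) 2 :=
    hinv _ (isRationalClass_eigenProjector_one hrat) (isOfHodgeType_eigenProjector_one hψ hhodge)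
      (isEig_zero_eigenProjector_one c)
  have h2 : c - eigenProjector (form ψ) 1 (2 * 2) (gammaW_le_diagonalStabilizer ψ) c ∈
      algebraicClasses (fibre ψ) 2 := by
    refine (Submodule.span_le.mpr ?_) (sub_eigenProjector_one_mem_span_reflInvariant hψ hrat hhodge)
    rintro x ⟨hxrat, hxhodge, hx⟩
    exact hrefl x hxrat hxhodge hx
  have h3 := Submodule.add_mem _ h1 h2
  rwa [add_sub_cancel] at h3

end Main

end Literature.AlgebraicGeometry.HodgeTheory.DworkSextic

end
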